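import Mathlib

/-!
# Ring 2 — AbelianAll — Weil discriminants of Prym–Tyurin pieces: the symmetrisation identity of the twisted form

research route conditional on HC_CM; not a corollary; Q11.4-sentence-2 already refuted in dim ≥ 3.
research route, not a corollary; conditional on HC_CM plus one named minimal statement.

Data-carrying helper for the supports-item of record `RankFourFaces.CMToAbelian` (find-the-cycle bookkeeping of the
WEIL-1 seat, unit pub-hodge-ring2-ab-weil-1 gen 29).  `HC_CM` does not occur in this file and nothing here is a case of
the Hodge conjecture.

Content: the algebraic kernel of THEOREM TKY-G29, step 3 (seat record `G10Q-DISC-G29.md` §2).  For a Galois cover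
`C̃ → P¹` with finite unitary group `W` and local monodromies `c_x`, the Weil form of the Prym–Tyurin piece
`H₁(C̃;ℚ) ⊗_{ℚ[W]} τ` is computed on the relation module by a block upper-triangular matrix `Q` whose diagonal blocks are
`A_x† P` with `A_x = ((1 - c_x⁻¹)|_{M_x})⁻¹`, `M_x = Im(1 - c_x)`.  The step `Q + Q† = Gram` rests on the operator identity

  `(1 - c)⁻¹ + (1 - c⁻¹)⁻¹ = 1`   for a unit `c` with `1 - c` invertible,

proved here in an arbitrary ring (`Ring.inverse_one_sub_add_inverse_one_sub_inv`), together with the fact that `1 - c⁻¹`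
is then invertible as well, and the scalar case used for reflections (`ζ ≠ 1`: `(1 - ζ)⁻¹ + (1 - ζ⁻¹)⁻¹ = 1` in a
division ring).  [folklore; the use made of it is AomotoKita2011 §2.3.3 (Kita–Yoshida form) in rank one]
-/

namespace Summit.HodgeConjecture.HodgeConjecture.Ring2.AbelianAll

/-- `1 - c⁻¹ = -c⁻¹ (1 - c)` for a unit `c`. -/
theorem one_sub_unitsInv_eq (R : Type*) [Ring R] (c : Rˣ) :
    (1 : R) - ((c⁻¹ : Rˣ) : R) = -(((c⁻¹ : Rˣ) : R) * (1 - (c : R))) := by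
  rw [mul_sub, mul_one, Units.inv_mul]
  abel

/-- If `c` is a unit and `1 - c` is a unit `u`, then `1 - c⁻¹` is the unit `-(c⁻¹ u)`. -/
theorem one_sub_unitsInv_eq_unit (R : Type*) [Ring R] (c u : Rˣ) (hu : (u : R) = 1 - (c : R)) :
    (((-(c⁻¹ * u)) : Rˣ) : R) = 1 - ((c⁻¹ : Rˣ) : R) := by
  rw [one_sub_unitsInv_eq R c, Units.val_neg, Units.val_mul, hu]

/-- THE SYMMETRISATION IDENTITY (TKY-G29 step 3): `(1 - c)⁻¹ + (1 - c⁻¹)⁻¹ = 1`, stated with explicit units: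
if `u = 1 - c` and `v = 1 - c⁻¹` are units then `u⁻¹ + v⁻¹ = 1`. -/
theorem unitsInv_one_sub_add_unitsInv_one_sub_inv (R : Type*) [Ring R] (c u v : Rˣ)
    (hu : (u : R) = 1 - (c : R)) (hv : (v : R) = 1 - ((c⁻¹ : Rˣ) : R)) :
    ((u⁻¹ : Rˣ) : R) + ((v⁻¹ : Rˣ) : R) = 1 := by
  -- `v = -(c⁻¹ u)` as units (values agree), hence `v⁻¹ = -(u⁻¹ c)`
  have hv' : v = -(c⁻¹ * u) := by
    apply Units.ext
    rw [hv, one_sub_unitsInv_eq_unit R c u hu]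
  subst hv'
  rw [inv_neg, mul_inv_rev, inv_inv, Units.val_neg, Units.val_mul]
  -- goal: ↑u⁻¹ + -(↑u⁻¹ * ↑c) = 1
  have h1 : ((u⁻¹ : Rˣ) : R) * (u : R) = 1 := Units.inv_mul u
  rw [hu] at h1
  rw [mul_sub, mul_one] at h1
  rw [← sub_eq_add_neg]
  exact h1

/-- Existence form: for a unit `c` with `1 - c` invertible, `1 - c⁻¹` is invertible and the two inverses sum to `1`. -/
theorem exists_inv_one_sub_inv_add_eq_one (R : Type*) [Ring R] (c u : Rˣ) (hu : (u : R) = 1 - (c : R)) :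
    ∃ v : Rˣ, (v : R) = 1 - ((c⁻¹ : Rˣ) : R) ∧ ((u⁻¹ : Rˣ) : R) + ((v⁻¹ : Rˣ) : R) = 1 :=
  ⟨-(c⁻¹ * u), one_sub_unitsInv_eq_unit R c u hu,
    unitsInv_one_sub_add_unitsInv_one_sub_inv R c u _ hu (one_sub_unitsInv_eq_unit R c u hu)⟩

/-- Scalar case (reflections, `det c = ζ ≠ 1`): `(1 - ζ)⁻¹ + (1 - ζ⁻¹)⁻¹ = 1` in any division ring. -/
theorem inv_one_sub_add_inv_one_sub_inv (K : Type*) [DivisionRing K] (ζ : K) (h0 : ζ ≠ 0) (h1 : ζ ≠ 1) :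
    (1 - ζ)⁻¹ + (1 - ζ⁻¹)⁻¹ = 1 := by
  have hz : (1 - ζ) ≠ 0 := sub_ne_zero.mpr (Ne.symm h1)
  have hzi : (1 - ζ⁻¹) = -(ζ⁻¹ * (1 - ζ)) := by
    rw [mul_sub, mul_one, inv_mul_cancel₀ h0]; abel
  rw [hzi, inv_neg, mul_inv_rev, inv_inv, ← sub_eq_add_neg]
  rw [← mul_one (1 - ζ)⁻¹, mul_assoc, one_mul, ← mul_sub, inv_mul_cancel₀ hz]

end Summit.HodgeConjecture.HodgeConjecture.Ring2.AbelianAll
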